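import Literature.NumberTheory.LFunctions.CriticalLineTwoThirdsTailProofs
import HarnessLib

/-!
# RH-FREE — «nothing here bears on the truth of RH»: Alpöge–Furman 2026 (arXiv:2608.13637) §5.1–5.2 set-up for Theorem 5.7 in the typed model — the real transforms `φ̂, Φ = (φ²)^`, a decay majorant `ϑ`, the Gabor kernel `K`, the matrix `G̃ + Ẽ` of (2.11) and the tail `Ẽ`, with `‖Ẽ‖_HS ≪ T^{−1/2}` and the perturbation step `|tr G̃² − tr(G̃+Ẽ)²| ≤ 2‖G̃+Ẽ‖_HS‖Ẽ‖_HS + ‖Ẽ‖²_HS` — definitions with bodies, everything else PROVED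

Topic `Literature/NumberTheory/LFunctions` (namespace `Literature.NumberTheory.LFunctions.AlpogeFurman2026`).
Cell `rh-columns/lit`, unit `rh-lit-frontier-1` (gen 7). Source: **[AF26]** L. Alpöge, R. Furman,
*More than two thirds of the zeros of the Riemann zeta function are simple and on the critical
line*, arXiv:2608.13637v2 (19 Aug 2026), UNREFEREED preprint (D-0012); locators = printed
equation / proposition numbers and pages of v2. NO claim, NO `sorry`; the definitions are the
source's own auxiliary objects, typed over `CriticalLineTwoThirdsMatrix.lean` (`φ_T = phi ψ T`,
`α_k = grid T L k`, `d = gridDim T`, `G̃ = gramMatrix ψ T`, `(aL²)⁻¹ = gramWeight ψ T`) and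
`CriticalLineTwoThirdsExplicitFormula.lean` (`ν_X = weilDensity X`, (2.11) `AlpogeFurman2026_gram_entry_formula`).

## What the source prints

* §5.1 (p. 7), eq. (5.1): "`Φ := (φ²)^`, `g := φ² ⋆ φ²`, …; thus `φ̂` and `Φ` are real, even, entire;
  `φ̂(0) ≤ L`, `Φ(0) = aL`"; eq. (5.3): "`max(|φ̂(r)|, |Φ(r)|) ≤ ϑ(r) := min(L, 2/|r|, C_χ/(w r²))`";
  (5.4): "`Θ₀ := ∫_0^∞ ϑ ≪ log L`, `∫ϑ² ≤ 8L`"; and (proof of Proposition 5.2, p. 9) "`ϑ` is decreasing, so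
  `σ(τ) ≤ Σ_{j≥0} ϑ(Δ + jh) ≤ ϑ(Δ) + h⁻¹∫_Δ^∞ ϑ`".
* §5.2 (p. 8), eq. (5.8): "`K(τ,τ′) := Σ_{0≤k<d} φ̂(τ−α_k)φ̂(τ′−α_k) = LΦ(τ−τ′) − K_out(τ,τ′)`,
  `K_out` denoting the sum over `k ∉ [0,d)`; by Lemma 2.1 …"; and
  "`(aL²)² ‖G̃+Ẽ‖²_HS = ∬ K(τ,τ′)² ν_X(τ)ν_X(τ′) dτ dτ′`" (by (2.11)).
* §2.3 (p. 5): "`Ẽ := (aL²)⁻¹ Σ_{Re γ_ρ ∉ I′} m_ρ v_ρ v_ρᵀ`", (2.11):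
  "`(G̃+Ẽ)_{kk′} = (aL²)⁻¹ ∫_ℝ φ̂(τ−α_k) φ̂(τ−α_{k′}) ν_X(τ) dτ`"; Proposition 4.3 (p. 7): "`‖Ẽ‖_HS ≤ ‖Ẽ‖₁ ≪ T^{−1/2}`".
* Theorem 5.7 (proof, last display, p. 11):
  "`|‖G̃‖²_HS − ‖G̃+Ẽ‖²_HS| ≤ 2‖G̃+Ẽ‖_HS‖Ẽ‖_HS + ‖Ẽ‖²_HS ≪ √N · T^{−1/2}` by Proposition 4.3."

## What is here

* §1 `hatR ψ T ξ` (= `φ̂_T(ξ)`, real, `hat_phi_ofReal`), `PhiR ψ T x` (= `Φ_T(x)`, `hat_phi_sq_ofReal`),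
  even (`hatR_neg`, `PhiR_neg`), `Φ(0) = ∫φ²` (`PhiR_zero`), `|φ̂ʳ| ≤ ∫φ`, `|Φ| ≤ ∫φ²` (`abs_hatR_le`),
  `∫φ ≤ √M L`, `∫φ² ≤ M L` (`integral_phi_le`), continuity (`continuous_hatR`). The majorant is the
  Lorentzian `lorentz M A r = 2A/(r² + A/M) ≥ min(M, A/r²)` (`le_lorentz`; even, decreasing on
  `[0,∞)`, `≤ 2M`, `≤ 2A/r²`, `∫_ℝ ϑ = 2π√(AM)`, `∫_{r>Δ} ϑ ≤ 2A/Δ`, `∫_{r>Δ} ϑ² ≤ 4A²/(3Δ³)`):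
  it keeps the two extreme branches of the printed `ϑ` (so `Θ₀ ≍ √L` instead of `log L`, which every
  later use absorbs) — `exists_majorant`: `|φ̂ʳ_T|, |Φ_T| ≤ ϑ_{A₀L, A₂}` for all `T` with `L ≥ 1`, by
  the second-order decay of `CriticalLineTwoThirdsWindowDecay`. Sums over arithmetic progressions of
  a decreasing function (`sum_step_le_integral`, `sum_step_le_add_integral`, `tsum_step_le_integral`).
* §2 Lemma 2.1 in real form `Σ_{k∈ℤ} φ̂ʳ(τ−α_k)φ̂ʳ(τ′−α_k) = LΦ(τ−τ′)` (`hasSum_hatR_mul_hatR`), the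
  kernel `kerK` (5.8), `kerKout := LΦ(τ−τ′) − K` with `hasSum_kerKout` (the sum over `k ∉ [0,d)`).
* §3 `sEntry ψ T k k′ = s_{kk′} := ∫ φ̂ʳ(τ−α_k)φ̂ʳ(τ−α_{k′})ν_X(τ)dτ` (integrable integrand, symmetric),
  (2.11) in real form `Σ_ρ m_ρ φ̂(γ_ρ−α_k)φ̂(γ_ρ−α_{k′}) = s_{kk′}` (`tsum_zeros_eq_sEntry`),
  `fullMatrix = (aL²)⁻¹ s` (= `G̃ + Ẽ`), `tailMatrix := fullMatrix − gramMatrix` (= `Ẽ`) with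
  `hasSum_tailMatrix_apply` (the printed sum over the zeros NOT seen by the window), and
  `sum_norm_sq_tailMatrix_le`: `‖Ẽ‖²_HS ≤ C²/T` (`T ≥ 300`, `L ≥ 10`) from Proposition 4.3
  (`AlpogeFurman2026_tail_partial_sum_normalised`) and `‖Σ m_ρ v_ρ v_ρᵀ‖_HS ≤ Σ m_ρ‖v_ρ‖₂²`
  (`sum_norm_sq_rankOne_le`), by passing to the limit over finite sets of far zeros.
* §4 `|tr(AB)| ≤ ‖A‖_HS‖B‖_HS`, `|tr(S−E)² − tr S²| ≤ 2‖S‖_HS‖E‖_HS + ‖E‖²_HS` (`norm_trace_sq_sub_le`),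
  `tr(G̃+Ẽ)² = ‖G̃+Ẽ‖²_HS = (aL²)⁻² Σ_{kk′} s²_{kk′}` (`trace_fullMatrix_sq`), and the assembled
  **`AlpogeFurman2026_trace_sq_perturbation`**: `|tr G̃² − H| ≤ 2√H·C/√T + C²/T` with
  `H = (aL²)⁻² Σ s²_{kk′}`.

Hilbert–Schmidt norms are written out as `√(Σ_{ij} ‖A_{ij}‖²)` (no matrix-norm instance is used).
STATUS NOTE (no endorsement). Book-keeping identities and elementary bounds; nothing here evaluates
`H` (that is Propositions 5.2–5.5 of the source) and nothing asserts Theorem 5.7, Theorem A, or RH.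

## References
* [AlpogeFurman2026] as above: §2.3 (pp. 4–5), eq. (2.11); Lemma 2.1 (p. 4); Proposition 4.3 (p. 7);
  §5.1 eqs. (5.1), (5.3), (5.4) (p. 7); §5.2 eq. (5.8) (p. 8); Theorem 5.7 (proof, p. 11).
-/

noncomputable section

open Complex Filter Set MeasureTheory
open scoped Real Topology ComplexConjugate

namespace Literature.NumberTheory.LFunctions

namespace AlpogeFurman2026

variable {ψ : ℝ → ℝ}

/-! ## §1. The real transforms `φ̂` (on `ℝ`) and `Φ = (φ²)^` -/

/-- `φ̂_T(ξ)` for REAL `ξ`, as a real number (it is real: `hat_phi_ofReal`). [cite: AlpogeFurman2026, §5.1 (p. 7: "`φ̂` and `Φ` are real, even, entire")] -/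
def hatR (ψ : ℝ → ℝ) (T ξ : ℝ) : ℝ := (hat (fun u ↦ (phi ψ T u : ℂ)) ξ).re

/-- **[AF26] §5.1 eq. (5.1)**: `Φ := (φ²)^` on `ℝ`, as a real number (`hat_phi_sq_ofReal`).
[cite: AlpogeFurman2026, §5.1 eq. (5.1) (p. 7)] -/
def PhiR (ψ : ℝ → ℝ) (T x : ℝ) : ℝ := (hat (fun u ↦ ((phi ψ T u ^ 2 : ℝ) : ℂ)) x).re

/-- `φ̂_T(ξ) = φ̂ʳ_T(ξ)` for real `ξ` (even real window ⇒ real transform). [cite: AlpogeFurman2026, §5.1 (p. 7)] -/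
theorem hat_phi_ofReal (heven : ∀ u, ψ (-u) = ψ u) (T ξ : ℝ) :
    hat (fun u ↦ (phi ψ T u : ℂ)) ξ = (hatR ψ T ξ : ℂ) := by
  apply Complex.ext
  · simp [hatR]
  · rw [Complex.ofReal_im]
    exact hat_ofReal_im_of_even (phi_neg heven T) ξ

/-- `(φ_T²)^(x) = Φ_T(x)` for real `x`. [cite: AlpogeFurman2026, §5.1 eq. (5.1) (p. 7)] -/
theorem hat_phi_sq_ofReal (heven : ∀ u, ψ (-u) = ψ u) (T x : ℝ) :
    hat (fun u ↦ ((phi ψ T u ^ 2 : ℝ) : ℂ)) x = (PhiR ψ T x : ℂ) := by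
  apply Complex.ext
  · simp [PhiR]
  · rw [Complex.ofReal_im]
    exact hat_ofReal_im_of_even (φ := fun u ↦ phi ψ T u ^ 2) (fun u ↦ by simp [phi_neg heven T]) x

/-- `φ̂ʳ` is even. [cite: AlpogeFurman2026, §5.1 (p. 7)] -/
theorem hatR_neg (heven : ∀ u, ψ (-u) = ψ u) (T ξ : ℝ) : hatR ψ T (-ξ) = hatR ψ T ξ := by
  simp only [hatR]
  rw [show ((-ξ : ℝ) : ℂ) = -(ξ : ℂ) by push_cast; ring, hat_neg_of_even (phi_neg heven T)]

/-- `Φ` is even. [cite: AlpogeFurman2026, §5.1 (p. 7)] -/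
theorem PhiR_neg (heven : ∀ u, ψ (-u) = ψ u) (T x : ℝ) : PhiR ψ T (-x) = PhiR ψ T x := by
  simp only [PhiR]
  rw [show ((-x : ℝ) : ℂ) = -(x : ℂ) by push_cast; ring]
  have := hat_neg_of_even (φ := fun u ↦ phi ψ T u ^ 2) (fun u ↦ by simp [phi_neg heven T]) (x : ℂ)
  simp only [Complex.ofReal_pow] at this ⊢
  rw [this]

/-- `Φ(0) = ∫ φ² = aL`. [cite: AlpogeFurman2026, §5.1 (p. 7: "`Φ(0) = aL`")] -/
theorem PhiR_zero (ψ : ℝ → ℝ) (T : ℝ) : PhiR ψ T 0 = ∫ u : ℝ, phi ψ T u ^ 2 := by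
  simp only [PhiR]
  rw [show ((0 : ℝ) : ℂ) = 0 from Complex.ofReal_zero, hat_zero, integral_complex_ofReal, Complex.ofReal_re]

/-- `φ_T²` is continuous. [cite: AlpogeFurman2026, §2.2 (p. 4)] -/
theorem IsWindow.continuous_phi_sq (hψ : IsWindow ψ) (T : ℝ) : Continuous fun u ↦ phi ψ T u ^ 2 :=
  (hψ.continuous_phi T).pow 2

/-- `φ_T²` has compact support. [cite: AlpogeFurman2026, §2.2 (p. 4)] -/
theorem hasCompactSupport_phi_sq (ψ : ℝ → ℝ) (T : ℝ) : HasCompactSupport fun u ↦ phi ψ T u ^ 2 := by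
  have h := (hasCompactSupport_phi ψ T).mul_right (f' := phi ψ T)
  have e : (fun u : ℝ ↦ phi ψ T u ^ 2) = phi ψ T * phi ψ T := by funext u; simp [pow_two]
  rw [e]; exact h

/-- `φ_T` and `φ_T²` are integrable. [cite: AlpogeFurman2026, §2.2 (p. 4)] -/
theorem IsWindow.integrable_phi (hψ : IsWindow ψ) (T : ℝ) : Integrable (phi ψ T) :=
  (hψ.continuous_phi T).integrable_of_hasCompactSupport (hasCompactSupport_phi ψ T)

/-- `φ_T²` is integrable. [cite: AlpogeFurman2026, §2.2 (p. 4)] -/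
theorem IsWindow.integrable_phi_sq (hψ : IsWindow ψ) (T : ℝ) : Integrable fun u ↦ phi ψ T u ^ 2 :=
  (hψ.continuous_phi_sq T).integrable_of_hasCompactSupport (hasCompactSupport_phi_sq ψ T)

/-- The support of `φ_T` has length `≤ L⁺`: `∫ φ_T ≤ √M · max L 0` when `ψ ≤ M` on `[−½,½]`, and
`∫ φ_T² ≤ M · max L 0`. [cite: AlpogeFurman2026, §2.2 (p. 4: "`‖φ‖₁ ≤ L`")] -/
theorem integral_phi_le (hψ : IsWindow ψ) {M : ℝ} (hM0 : 0 ≤ M)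
    (hM : ∀ x ∈ Icc (-(1 / 2 : ℝ)) (1 / 2), ψ x ≤ M) (T : ℝ) :
    (∫ u : ℝ, phi ψ T u) ≤ Real.sqrt M * max (logHeight T) 0 ∧
      (∫ u : ℝ, phi ψ T u ^ 2) ≤ M * max (logHeight T) 0 := by
  set L := logHeight T with hLdef
  have hsup : ∀ u, phi ψ T u ≤ Real.sqrt M := fun u ↦ phi_le_sqrt hM T u
  have hL' : 0 ≤ max L 0 := le_max_right _ _
  have hsupp : ∀ u, phi ψ T u ≠ 0 → u ∈ Icc (-(max L 0 / 2)) (max L 0 / 2) := by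
    intro u hu
    have h := support_phi_subset ψ T (Function.mem_support.2 hu)
    rw [← hLdef] at h
    exact ⟨by linarith [h.1, le_max_left L 0], by linarith [h.2, le_max_left L 0]⟩
  have hzero : ∀ u ∉ Icc (-(max L 0 / 2)) (max L 0 / 2), phi ψ T u = 0 := by
    intro u hu; by_contra h; exact hu (hsupp u h)
  have hzero2 : ∀ u ∉ Icc (-(max L 0 / 2)) (max L 0 / 2), phi ψ T u ^ 2 = 0 := fun u hu ↦ by
    simp [hzero u hu]
  have hvol : volume.real (Icc (-(max L 0 / 2)) (max L 0 / 2)) = max L 0 := by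
    rw [Real.volume_real_Icc_of_le (by linarith)]; ring
  constructor
  · rw [← setIntegral_eq_integral_of_forall_compl_eq_zero hzero]
    calc ∫ u in Icc (-(max L 0 / 2)) (max L 0 / 2), phi ψ T u
        ≤ ∫ u in Icc (-(max L 0 / 2)) (max L 0 / 2), Real.sqrt M :=
          setIntegral_mono (hψ.integrable_phi T).integrableOn (continuous_const.integrableOn_Icc)
            fun u ↦ hsup u
      _ = Real.sqrt M * max L 0 := by rw [setIntegral_const, hvol, smul_eq_mul, mul_comm]
  · rw [← setIntegral_eq_integral_of_forall_compl_eq_zero hzero2]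
    calc ∫ u in Icc (-(max L 0 / 2)) (max L 0 / 2), phi ψ T u ^ 2
        ≤ ∫ u in Icc (-(max L 0 / 2)) (max L 0 / 2), M := by
          refine setIntegral_mono (hψ.integrable_phi_sq T).integrableOn
            (continuous_const.integrableOn_Icc) fun u ↦ ?_
          have h := pow_le_pow_left₀ (phi_nonneg ψ T u) (hsup u) 2
          rwa [Real.sq_sqrt hM0] at h
      _ = M * max L 0 := by rw [setIntegral_const, hvol, smul_eq_mul, mul_comm]

/-- The trivial bounds `|φ̂ʳ(ξ)| ≤ ∫ φ` and `|Φ(x)| ≤ ∫ φ²`. [cite: AlpogeFurman2026, §5.1 (p. 7: "`φ̂(0) ≤ L`, `Φ(0) = aL`")] -/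
theorem abs_hatR_le (ψ : ℝ → ℝ) (T ξ x : ℝ) :
    |hatR ψ T ξ| ≤ ∫ u : ℝ, phi ψ T u ∧ |PhiR ψ T x| ≤ ∫ u : ℝ, phi ψ T u ^ 2 := by
  have key : ∀ (f : ℝ → ℝ), (∀ u, 0 ≤ f u) → ∀ ξ : ℝ,
      |(hat (fun u ↦ (f u : ℂ)) ξ).re| ≤ ∫ u : ℝ, f u := by
    intro f hf ξ
    refine (Complex.abs_re_le_norm _).trans ?_
    rw [hat]
    refine (norm_integral_le_integral_norm _).trans (le_of_eq ?_)
    refine integral_congr_ae (Eventually.of_forall fun u ↦ ?_)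
    dsimp only
    rw [norm_mul, Complex.norm_exp, Complex.norm_real, Real.norm_eq_abs, abs_of_nonneg (hf u)]
    have hre : (-(I * (ξ : ℂ) * (u : ℂ))).re = 0 := by simp
    rw [hre, Real.exp_zero, mul_one]
  refine ⟨key _ (phi_nonneg ψ T) ξ, ?_⟩
  have := key (fun u ↦ phi ψ T u ^ 2) (fun u ↦ sq_nonneg _) x
  simp only [Complex.ofReal_pow] at this
  simpa [PhiR] using this

/-! ### The Lorentzian majorant `ϑ_{M,A}(r) = 2A/(r² + A/M)` of `min(M, A/r²)`

[AF26] (5.3) majorises `|φ̂|, |Φ|` by `ϑ(r) = min(L, 2/|r|, C_χ/(w r²))`; we use the two extreme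
branches only, smoothed into one Lorentzian (even, decreasing in `|r|`, integrable, with
closed-form tail integrals). This costs `√L` in place of `log L` in `Θ₀ = ∫ϑ`, which every use below
absorbs. -/

/-- The Lorentzian majorant `ϑ_{M,A}(r) := 2A/(r² + A/M)` (`≥ min(M, A/r²)`, `le_lorentz`).
[cite: AlpogeFurman2026, §5.1 eq. (5.3) (p. 7)] -/
def lorentz (M A r : ℝ) : ℝ := 2 * A / (r ^ 2 + A / M)

/-- `ϑ > 0`. [cite: AlpogeFurman2026, §5.1 eq. (5.3) (p. 7)] -/
theorem lorentz_pos {M A : ℝ} (hM : 0 < M) (hA : 0 < A) (r : ℝ) : 0 < lorentz M A r := by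
  unfold lorentz; positivity

/-- `ϑ` is even. [cite: AlpogeFurman2026, §5.1 eq. (5.3) (p. 7)] -/
theorem lorentz_neg (M A r : ℝ) : lorentz M A (-r) = lorentz M A r := by simp [lorentz]

/-- `ϑ ≤ 2M`. [cite: AlpogeFurman2026, §5.1 eq. (5.3) (p. 7)] -/
theorem lorentz_le_two_mul {M A : ℝ} (hM : 0 < M) (hA : 0 < A) (r : ℝ) : lorentz M A r ≤ 2 * M := by
  unfold lorentz
  rw [div_le_iff₀ (by positivity)]
  have : 2 * M * (r ^ 2 + A / M) = 2 * M * r ^ 2 + 2 * A := by field_simp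
  nlinarith [sq_nonneg r, hM.le]

/-- `ϑ(r) ≤ 2A/r²`. [cite: AlpogeFurman2026, §5.1 eq. (5.3) (p. 7)] -/
theorem lorentz_le_div_sq {M A : ℝ} (hM : 0 < M) (hA : 0 < A) {r : ℝ} (hr : r ≠ 0) :
    lorentz M A r ≤ 2 * A / r ^ 2 := by
  unfold lorentz
  exact div_le_div_of_nonneg_left (by positivity) (by positivity) (by linarith [(div_pos hA hM).le])

/-- **The majorant property**: `f ≤ M` and (`r ≠ 0 ⇒ f ≤ A/r²`) imply `f ≤ ϑ_{M,A}(r)`.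
[cite: AlpogeFurman2026, §5.1 eq. (5.3) (p. 7)] -/
theorem le_lorentz {M A f r : ℝ} (hM : 0 < M) (hA : 0 < A) (h1 : f ≤ M) (h2 : r ≠ 0 → f ≤ A / r ^ 2) :
    f ≤ lorentz M A r := by
  unfold lorentz
  have hden : 0 < r ^ 2 + A / M := by positivity
  rw [le_div_iff₀ hden]
  by_cases hr : r ^ 2 ≤ A / M
  · calc f * (r ^ 2 + A / M) ≤ M * (r ^ 2 + A / M) := mul_le_mul_of_nonneg_right h1 hden.le
      _ ≤ M * (A / M + A / M) := by gcongr
      _ = 2 * A := by field_simp; ring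
  · push Not at hr
    have hr0 : r ≠ 0 := by
      rintro rfl
      have : (0 : ℝ) < A / M := div_pos hA hM
      simp at hr; linarith
    have hr2 : 0 < r ^ 2 := by positivity
    calc f * (r ^ 2 + A / M) ≤ A / r ^ 2 * (r ^ 2 + A / M) :=
          mul_le_mul_of_nonneg_right (h2 hr0) hden.le
      _ = A + A * ((A / M) / r ^ 2) := by field_simp
      _ ≤ A + A * 1 := by gcongr; rw [div_le_one hr2]; exact hr.le
      _ = 2 * A := by ring

/-- `ϑ` is decreasing on `[0, ∞)`. [cite: AlpogeFurman2026, §5.1 eq. (5.3) (p. 7: "`ϑ` is decreasing")] -/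
theorem lorentz_antitoneOn {M A : ℝ} (hM : 0 < M) (hA : 0 < A) : AntitoneOn (lorentz M A) (Ici 0) := by
  intro r hr s _ hrs
  unfold lorentz
  have : r ^ 2 ≤ s ^ 2 := pow_le_pow_left₀ hr hrs 2
  exact div_le_div_of_nonneg_left (by positivity) (by positivity) (by linarith)

/-- `ϑ = (2A/c²)(1 + (r/c)²)⁻¹` with `c = √(A/M)`. [folklore] -/
private theorem lorentz_eq_scaled {M A : ℝ} (hM : 0 < M) (hA : 0 < A) (r : ℝ) :
    lorentz M A r = 2 * A / (A / M) * (1 + (Real.sqrt (A / M))⁻¹ * r * ((Real.sqrt (A / M))⁻¹ * r))⁻¹ := by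
  have hq : 0 < A / M := div_pos hA hM
  have hc : 0 < Real.sqrt (A / M) := Real.sqrt_pos.2 hq
  have hc2 : (Real.sqrt (A / M))⁻¹ * r * ((Real.sqrt (A / M))⁻¹ * r) = r ^ 2 / (A / M) := by
    rw [show (Real.sqrt (A / M))⁻¹ * r * ((Real.sqrt (A / M))⁻¹ * r) =
      r ^ 2 * ((Real.sqrt (A / M)) ^ 2)⁻¹ by ring, Real.sq_sqrt hq.le, ← div_eq_mul_inv]
  rw [hc2]
  unfold lorentz
  have h1 : (1 + r ^ 2 / (A / M)) = (r ^ 2 + A / M) / (A / M) := by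
    field_simp; ring
  rw [h1, inv_div, div_mul_div_comm, mul_comm (2 * A) (A / M), ← div_mul_div_comm, div_self hq.ne', one_mul]

/-- `ϑ` is continuous and integrable, `∫_ℝ ϑ_{M,A} = 2π √(AM)` (so `Θ₀ ≍ √(LA)` for `M ≍ L`).
[cite: AlpogeFurman2026, §5.1 eq. (5.4) (p. 7)] -/
theorem integral_lorentz {M A : ℝ} (hM : 0 < M) (hA : 0 < A) :
    Continuous (lorentz M A) ∧ Integrable (lorentz M A) ∧
      ∫ r, lorentz M A r = 2 * π * Real.sqrt (A * M) := by
  have hc : 0 < Real.sqrt (A / M) := Real.sqrt_pos.2 (div_pos hA hM)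
  set c := Real.sqrt (A / M) with hcdef
  have hfun : lorentz M A = fun r ↦ 2 * A / (A / M) * (fun s : ℝ ↦ (1 + s * s)⁻¹) (c⁻¹ * r) := by
    funext r; rw [lorentz_eq_scaled hM hA]
  have hcont : Continuous (lorentz M A) := by
    unfold lorentz
    refine continuous_const.div (by fun_prop) fun r ↦ ?_
    have : 0 < r ^ 2 + A / M := by positivity
    exact this.ne'
  have hint1 : Integrable fun s : ℝ ↦ (1 + s * s)⁻¹ := by
    have := integrable_inv_one_add_sq
    simpa [pow_two] using this
  have hint : Integrable (lorentz M A) := by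
    rw [hfun]
    exact ((hint1.comp_mul_left' (inv_ne_zero hc.ne')).const_mul _)
  refine ⟨hcont, hint, ?_⟩
  rw [hfun, integral_const_mul, Measure.integral_comp_mul_left (fun s : ℝ ↦ (1 + s * s)⁻¹) (c⁻¹)]
  rw [inv_inv, abs_of_pos hc]
  have hI : ∫ s : ℝ, (1 + s * s)⁻¹ = π := by
    have := integral_univ_inv_one_add_sq
    simpa [pow_two] using this
  rw [hI, smul_eq_mul]
  -- `2A/(A/M) · c · π = 2π √(AM)` with `c = √(A/M)`
  have hc2 : c ^ 2 = A / M := Real.sq_sqrt (div_pos hA hM).le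
  have hAM : Real.sqrt (A * M) = c * M := by
    rw [show A * M = (c * M) ^ 2 by rw [mul_pow, hc2]; field_simp, Real.sqrt_sq (by positivity)]
  rw [hAM]
  field_simp

/-- Tail integrals of `ϑ`: `∫_{r>Δ} ϑ ≤ 2π√(AM)` (`Δ` arbitrary) and `≤ 2A/Δ` (`Δ > 0`), from
`ϑ ≤ 2A/r²`. [cite: AlpogeFurman2026, §5.1 (p. 7: "`∫_Δ^∞ ϑ ≤ min(Θ₀, C_χ/(wΔ))`")] -/
theorem setIntegral_lorentz_le {M A : ℝ} (hM : 0 < M) (hA : 0 < A) (Δ : ℝ) :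
    IntegrableOn (lorentz M A) (Ioi Δ) ∧
      (∫ r in Ioi Δ, lorentz M A r) ≤ 2 * π * Real.sqrt (A * M) ∧
      (0 < Δ → (∫ r in Ioi Δ, lorentz M A r) ≤ 2 * A / Δ) := by
  obtain ⟨hcont, hint, hI⟩ := integral_lorentz hM hA
  refine ⟨hint.integrableOn, ?_, fun hΔ ↦ ?_⟩
  · rw [← hI]
    exact setIntegral_le_integral hint (Eventually.of_forall fun r ↦ (lorentz_pos hM hA r).le)
  · have h2 : IntegrableOn (fun r : ℝ ↦ 2 * A * r ^ (-2 : ℝ)) (Ioi Δ) :=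
      ((integrableOn_Ioi_rpow_of_lt (by norm_num) hΔ).const_mul _)
    calc ∫ r in Ioi Δ, lorentz M A r ≤ ∫ r in Ioi Δ, 2 * A * r ^ (-2 : ℝ) := by
          refine setIntegral_mono_on hint.integrableOn h2 measurableSet_Ioi fun r hr ↦ ?_
          have hr0 : 0 < r := hΔ.trans hr
          rw [Real.rpow_neg hr0.le, Real.rpow_two, ← div_eq_mul_inv]
          exact lorentz_le_div_sq hM hA hr0.ne'
      _ = 2 * A / Δ := by
          rw [integral_const_mul, integral_Ioi_rpow_of_lt (by norm_num) hΔ]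
          have : Δ ^ ((-2 : ℝ) + 1) = Δ⁻¹ := by
            rw [show (-2 : ℝ) + 1 = -1 by norm_num, Real.rpow_neg_one]
          rw [this]; field_simp; norm_num

/-- Tail integrals of `ϑ²`: integrable on `(Δ, ∞)`, `∫_{r>Δ} ϑ² ≤ 2M ∫_{r>Δ} ϑ` and, for `Δ > 0`,
`∫_{r>Δ} ϑ² ≤ 4A²/(3Δ³)`. [cite: AlpogeFurman2026, §5.1 eq. (5.4) (p. 7)] -/
theorem setIntegral_lorentz_sq_le {M A : ℝ} (hM : 0 < M) (hA : 0 < A) (Δ : ℝ) :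
    IntegrableOn (fun r ↦ lorentz M A r ^ 2) (Ioi Δ) ∧
      (∫ r in Ioi Δ, lorentz M A r ^ 2) ≤ 2 * M * ∫ r in Ioi Δ, lorentz M A r ∧
      (0 < Δ → (∫ r in Ioi Δ, lorentz M A r ^ 2) ≤ 4 * A ^ 2 / (3 * Δ ^ 3)) := by
  obtain ⟨hcont, hint, -⟩ := integral_lorentz hM hA
  have hsq : IntegrableOn (fun r ↦ lorentz M A r ^ 2) (Ioi Δ) := by
    have : IntegrableOn (fun r ↦ 2 * M * lorentz M A r) (Ioi Δ) := (hint.const_mul _).integrableOn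
    refine this.mono' (by fun_prop) (Eventually.of_forall fun r ↦ ?_)
    rw [Real.norm_eq_abs, abs_of_nonneg (sq_nonneg _), pow_two]
    exact mul_le_mul_of_nonneg_right (lorentz_le_two_mul hM hA r) (lorentz_pos hM hA r).le
  refine ⟨hsq, ?_, fun hΔ ↦ ?_⟩
  · rw [← integral_const_mul]
    refine setIntegral_mono_on hsq ((hint.const_mul _).integrableOn) measurableSet_Ioi fun r _ ↦ ?_
    rw [pow_two]
    exact mul_le_mul_of_nonneg_right (lorentz_le_two_mul hM hA r) (lorentz_pos hM hA r).le
  · have h2 : IntegrableOn (fun r : ℝ ↦ 4 * A ^ 2 * r ^ (-4 : ℝ)) (Ioi Δ) :=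
      ((integrableOn_Ioi_rpow_of_lt (by norm_num) hΔ).const_mul _)
    calc ∫ r in Ioi Δ, lorentz M A r ^ 2 ≤ ∫ r in Ioi Δ, 4 * A ^ 2 * r ^ (-4 : ℝ) := by
          refine setIntegral_mono_on hsq h2 measurableSet_Ioi fun r hr ↦ ?_
          have hr0 : 0 < r := hΔ.trans hr
          have h := lorentz_le_div_sq hM hA hr0.ne'
          have h' := pow_le_pow_left₀ (lorentz_pos hM hA r).le h 2
          refine h'.trans (le_of_eq ?_)
          rw [Real.rpow_neg hr0.le, show (4 : ℝ) = ((4 : ℕ) : ℝ) by norm_num, Real.rpow_natCast]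
          field_simp
          ring
      _ = 4 * A ^ 2 / (3 * Δ ^ 3) := by
          rw [integral_const_mul, integral_Ioi_rpow_of_lt (by norm_num) hΔ]
          have : Δ ^ ((-4 : ℝ) + 1) = (Δ ^ 3)⁻¹ := by
            rw [show (-4 : ℝ) + 1 = -3 by norm_num, Real.rpow_neg hΔ.le,
              show (3 : ℝ) = ((3 : ℕ) : ℝ) by norm_num, Real.rpow_natCast]
          rw [this]; field_simp; norm_num

/-! ### Sums of a decreasing function over an arithmetic progression -/

/-- For `g ≥ 0` decreasing on `[Δ, ∞)` and integrable there, and a step `h > 0`: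
`Σ_{j<n} g(Δ + (j+1)h) ≤ h⁻¹ ∫_{x>Δ} g`. [cite: AlpogeFurman2026, Proposition 5.2 (proof: "`σ(τ) ≤ Σ_j ϑ(Δ+jh) ≤ ϑ(Δ) + h⁻¹∫_Δ^∞ ϑ`"), p. 9] -/
theorem sum_step_le_integral {g : ℝ → ℝ} {Δ h : ℝ} (hh : 0 < h) (hanti : AntitoneOn g (Ici Δ))
    (hg0 : ∀ x, Δ ≤ x → 0 ≤ g x) (hint : IntegrableOn g (Ioi Δ)) (n : ℕ) :
    ∑ j ∈ Finset.range n, g (Δ + (j + 1) * h) ≤ h⁻¹ * ∫ x in Ioi Δ, g x := by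
  -- `F(x) = g(h x + Δ)` is decreasing on `[0, n]`
  have hF : AntitoneOn (fun x : ℝ ↦ g (h * x + Δ)) (Icc (0 : ℝ) (0 + n)) := by
    intro x hx y hy hxy
    refine hanti ?_ ?_ (by linarith [mul_le_mul_of_nonneg_left hxy hh.le])
    · exact le_add_of_nonneg_left (mul_nonneg hh.le hx.1)
    · exact le_add_of_nonneg_left (mul_nonneg hh.le hy.1)
  have h1 := AntitoneOn.sum_le_integral hF
  simp only [zero_add] at h1
  have h2 : ∑ j ∈ Finset.range n, g (Δ + (j + 1) * h) =
      ∑ i ∈ Finset.range n, g (h * ((i + 1 : ℕ) : ℝ) + Δ) := by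
    refine Finset.sum_congr rfl fun i _ ↦ ?_
    push_cast; ring_nf
  rw [h2]
  refine h1.trans ?_
  -- substitute and enlarge the range of integration
  rw [intervalIntegral.integral_comp_mul_add (fun x ↦ g x) hh.ne', smul_eq_mul]
  simp only [mul_zero, zero_add]
  refine mul_le_mul_of_nonneg_left ?_ (inv_nonneg.2 hh.le)
  rw [intervalIntegral.integral_of_le (by nlinarith [hh.le, (n.cast_nonneg : (0 : ℝ) ≤ n)])]
  exact setIntegral_mono_set hint
    ((ae_restrict_iff' measurableSet_Ioi).2 (ae_of_all _ fun x hx ↦ hg0 x (le_of_lt hx)))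
    Ioc_subset_Ioi_self.eventuallyLE

/-- The same with the first term: `Σ_{j<n} g(Δ + jh) ≤ g(Δ) + h⁻¹ ∫_{x>Δ} g`.
[cite: AlpogeFurman2026, Proposition 5.2 (proof), p. 9] -/
theorem sum_step_le_add_integral {g : ℝ → ℝ} {Δ h : ℝ} (hh : 0 < h) (hanti : AntitoneOn g (Ici Δ))
    (hg0 : ∀ x, Δ ≤ x → 0 ≤ g x) (hint : IntegrableOn g (Ioi Δ)) (n : ℕ) :
    ∑ j ∈ Finset.range n, g (Δ + j * h) ≤ g Δ + h⁻¹ * ∫ x in Ioi Δ, g x := by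
  cases n with
  | zero =>
    simp only [Finset.range_zero, Finset.sum_empty]
    have : 0 ≤ ∫ x in Ioi Δ, g x := setIntegral_nonneg measurableSet_Ioi fun x hx ↦ hg0 x (le_of_lt hx)
    have := hg0 Δ le_rfl
    positivity
  | succ m =>
    rw [Finset.sum_range_succ']
    simp only [Nat.cast_zero, zero_mul, add_zero]
    have := sum_step_le_integral hh hanti hg0 hint m
    have e : ∑ j ∈ Finset.range m, g (Δ + ((j + 1 : ℕ) : ℝ) * h) =
        ∑ j ∈ Finset.range m, g (Δ + (j + 1) * h) := by
      refine Finset.sum_congr rfl fun j _ ↦ ?_; push_cast; ring_nf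
    rw [e]; linarith

/-- Infinite version: `Σ_{j≥0} g(Δ + (j+1)h)` converges and is `≤ h⁻¹ ∫_{x>Δ} g`.
[cite: AlpogeFurman2026, Proposition 5.2 (proof), p. 9] -/
theorem tsum_step_le_integral {g : ℝ → ℝ} {Δ h : ℝ} (hh : 0 < h) (hanti : AntitoneOn g (Ici Δ))
    (hg0 : ∀ x, Δ ≤ x → 0 ≤ g x) (hint : IntegrableOn g (Ioi Δ)) :
    Summable (fun j : ℕ ↦ g (Δ + (j + 1) * h)) ∧
      ∑' j : ℕ, g (Δ + (j + 1) * h) ≤ h⁻¹ * ∫ x in Ioi Δ, g x := by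
  have hnn : ∀ j : ℕ, 0 ≤ g (Δ + (j + 1) * h) := fun j ↦ hg0 _ (by nlinarith [hh.le, (j.cast_nonneg : (0:ℝ) ≤ j)])
  have hbd := sum_step_le_integral hh hanti hg0 hint
  have hs : Summable (fun j : ℕ ↦ g (Δ + (j + 1) * h)) := summable_of_sum_range_le hnn hbd
  exact ⟨hs, hs.tsum_le_of_sum_range_le hbd⟩

/-! ### The majorant for the typed window -/

/-- **[AF26] (2.8)/(5.3) for the typed window, in majorant form**: for a window `ψ` there are
`A₀, A₂ > 0` with `|φ̂ʳ_T(ξ)| ≤ ϑ_{A₀L, A₂}(ξ)` and `|Φ_T(x)| ≤ ϑ_{A₀L, A₂}(x)` for all `T` with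
`L = log(T/2π) ≥ 1` and all real `ξ, x` (trivial bounds `∫φ, ∫φ² ≤ A₀L` and the second-order decay
of `CriticalLineTwoThirdsWindowDecay`). [cite: AlpogeFurman2026, §2.2 eq. (2.8), §5.1 eq. (5.3) (pp. 4, 7)] -/
theorem exists_majorant (hψ : IsWindow ψ) :
    ∃ A₀ A₂ : ℝ, 0 < A₀ ∧ 0 < A₂ ∧ ∀ T : ℝ, 1 ≤ logHeight T → ∀ ξ : ℝ,
      |hatR ψ T ξ| ≤ lorentz (A₀ * logHeight T) A₂ ξ ∧
        |PhiR ψ T ξ| ≤ lorentz (A₀ * logHeight T) A₂ ξ := by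
  obtain ⟨m₀, B, K, -, hB0, -, -, hB, -⟩ := hψ.exists_bounds
  obtain ⟨C₁, hC₁0, hC₁⟩ := exists_norm_hat_phi_le_inv_sq' hψ
  obtain ⟨C₂, hC₂0, hC₂⟩ := exists_norm_hat_phi_sq_ofReal_le hψ
  have hM : ∀ x ∈ Icc (-(1 / 2 : ℝ)) (1 / 2), ψ x ≤ B ^ 2 := by
    intro x hx
    have h := pow_le_pow_left₀ (Real.sqrt_nonneg _) (hB x hx) 2
    rwa [Real.sq_sqrt (hψ.pos x hx).le] at h
  refine ⟨B + B ^ 2 + 1, max C₁ C₂ + 1, by positivity, by positivity, fun T hT ξ ↦ ?_⟩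
  set L := logHeight T with hLdef
  have hL0 : 0 < L := by linarith
  obtain ⟨h1, h2⟩ := integral_phi_le hψ (by positivity) hM T
  rw [← hLdef, max_eq_left hL0.le] at h1 h2
  have hsB : Real.sqrt (B ^ 2) = B := Real.sqrt_sq hB0
  rw [hsB] at h1
  obtain ⟨h3, h4⟩ := abs_hatR_le ψ T ξ ξ
  have hMpos : 0 < (B + B ^ 2 + 1) * L := by positivity
  constructor
  · refine le_lorentz hMpos (by positivity) (h3.trans (h1.trans ?_)) fun hξ ↦ ?_
    · nlinarith [sq_nonneg B]
    · have h := hC₁ T hT ξ 0 (Or.inl hξ)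
      simp only [Complex.ofReal_zero, zero_mul, add_zero, abs_zero, mul_zero, zero_div, Real.exp_zero,
        mul_one, ne_eq, OfNat.ofNat_ne_zero, not_false_eq_true, zero_pow] at h
      rw [hat_phi_ofReal hψ.even, Complex.norm_real, Real.norm_eq_abs] at h
      refine h.trans ?_
      gcongr
      linarith [le_max_left C₁ C₂]
  · refine le_lorentz hMpos (by positivity) (h4.trans (h2.trans ?_)) fun hξ ↦ ?_
    · nlinarith [sq_nonneg B, hB0]
    · have h := hC₂ T hT ξ hξ
      rw [hat_phi_sq_ofReal hψ.even, Complex.norm_real, Real.norm_eq_abs] at h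
      refine h.trans ?_
      gcongr
      linarith [le_max_right C₁ C₂]

/-! ### Continuity of the transforms -/

/-- `ξ ↦ f̂(ξ)` is continuous on `ℝ` for integrable `f` (dominated convergence). [folklore] -/
private theorem continuous_hat_ofReal {f : ℝ → ℂ} (hf : Integrable f) :
    Continuous fun ξ : ℝ ↦ hat f ξ := by
  simp only [hat]
  refine continuous_of_dominated (bound := fun u ↦ ‖f u‖) (fun ξ ↦ ?_) (fun ξ ↦ ?_) hf.norm ?_
  · exact (hf.aestronglyMeasurable.mul (by fun_prop : Continuous fun u : ℝ ↦
      cexp (-(I * (ξ : ℂ) * u))).aestronglyMeasurable)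
  · refine Eventually.of_forall fun u ↦ ?_
    rw [norm_mul, Complex.norm_exp]
    have : (-(I * (ξ : ℂ) * (u : ℂ))).re = 0 := by simp
    rw [this, Real.exp_zero, mul_one]
  · exact Eventually.of_forall fun u ↦ by fun_prop

/-- `φ̂ʳ_T` and `Φ_T` are continuous. [cite: AlpogeFurman2026, §5.1 (p. 7)] -/
theorem continuous_hatR (hψ : IsWindow ψ) (T : ℝ) :
    Continuous (hatR ψ T) ∧ Continuous (PhiR ψ T) := by
  constructor
  · have h := continuous_hat_ofReal ((hψ.integrable_phi T).ofReal (𝕜 := ℂ))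
    exact Complex.continuous_re.comp h
  · have h := continuous_hat_ofReal ((hψ.integrable_phi_sq T).ofReal (𝕜 := ℂ))
    exact Complex.continuous_re.comp h

/-! ## §2. The Gabor kernel `K` and the Poisson–Gabor identity in real form -/

/-- **[AF26] Lemma 2.1 on the real axis, real form**: `Σ_{k∈ℤ} φ̂ʳ(τ − α_k) φ̂ʳ(τ′ − α_k) = L Φ(τ − τ′)`.
[cite: AlpogeFurman2026, Lemma 2.1 (p. 4)] -/
theorem hasSum_hatR_mul_hatR (hψ : IsWindow ψ) {T : ℝ} (hL : 0 < logHeight T) (τ τ' : ℝ) :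
    HasSum (fun k : ℤ ↦ hatR ψ T (τ - grid T (logHeight T) k) * hatR ψ T (τ' - grid T (logHeight T) k))
      (logHeight T * PhiR ψ T (τ - τ')) := by
  have hφc : Continuous fun u : ℝ ↦ (phi ψ T u : ℂ) :=
    Complex.continuous_ofReal.comp (hψ.continuous_phi T)
  have hsupp : Function.support (fun u : ℝ ↦ (phi ψ T u : ℂ)) ⊆
      Ioo (-(logHeight T / 2)) (logHeight T / 2) := by
    intro u hu
    apply support_phi_subset ψ T
    simpa [Function.mem_support] using hu
  have heven : ∀ u, ((phi ψ T (-u) : ℝ) : ℂ) = (phi ψ T u : ℂ) := fun u ↦ by rw [phi_neg hψ.even]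
  have h := Complex.hasSum_re (AlpogeFurman2026_poisson_gabor hL T hφc hsupp heven (τ : ℂ) (τ' : ℂ))
  convert h using 1
  · funext k
    rw [show (τ : ℂ) - (grid T (logHeight T) k : ℂ) = ((τ - grid T (logHeight T) k : ℝ) : ℂ) by
        push_cast; ring,
      show (τ' : ℂ) - (grid T (logHeight T) k : ℂ) = ((τ' - grid T (logHeight T) k : ℝ) : ℂ) by
        push_cast; ring,
      hat_phi_ofReal hψ.even, hat_phi_ofReal hψ.even, ← Complex.ofReal_mul, Complex.ofReal_re]
  · rw [show (τ : ℂ) - (τ' : ℂ) = ((τ - τ' : ℝ) : ℂ) by push_cast; ring]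
    have e : (fun u : ℝ ↦ (phi ψ T u : ℂ) ^ 2) = fun u ↦ ((phi ψ T u ^ 2 : ℝ) : ℂ) := by
      funext u; push_cast; ring
    rw [e, hat_phi_sq_ofReal hψ.even, ← Complex.ofReal_mul, Complex.ofReal_re]

/-- The index set `{0, …, d−1} ⊂ ℤ` of the compression. [cite: AlpogeFurman2026, §2.2 (p. 4)] -/
def gridIdx (T : ℝ) : Finset ℤ := Finset.univ.image fun k : Fin (gridDim T) ↦ ((k : ℕ) : ℤ)

/-- `k ∈ gridIdx T ↔ 0 ≤ k < d`. [cite: AlpogeFurman2026, §2.2 (p. 4)] -/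
theorem mem_gridIdx {T : ℝ} {k : ℤ} : k ∈ gridIdx T ↔ 0 ≤ k ∧ k < gridDim T := by
  simp only [gridIdx, Finset.mem_image, Finset.mem_univ, true_and]
  constructor
  · rintro ⟨j, rfl⟩; exact ⟨by positivity, by exact_mod_cast j.2⟩
  · rintro ⟨h0, h1⟩
    refine ⟨⟨k.toNat, by omega⟩, by simp; omega⟩

/-- Sums over `gridIdx T` are sums over `Fin d`. [cite: AlpogeFurman2026, §2.2 (p. 4)] -/
theorem sum_gridIdx {M : Type*} [AddCommMonoid M] (T : ℝ) (f : ℤ → M) :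
    ∑ k ∈ gridIdx T, f k = ∑ k : Fin (gridDim T), f ((k : ℕ) : ℤ) := by
  rw [gridIdx, Finset.sum_image]
  intro a _ b _ h
  simp only [Nat.cast_inj] at h
  exact Fin.ext h

/-- **[AF26] eq. (5.8), the Gabor kernel of the compression**
`K(τ, τ′) := Σ_{0≤k<d} φ̂(τ − α_k) φ̂(τ′ − α_k)`. [cite: AlpogeFurman2026, §5.2, display before Proposition 5.2 (p. 8)] -/
def kerK (ψ : ℝ → ℝ) (T τ τ' : ℝ) : ℝ :=
  ∑ k : Fin (gridDim T), hatR ψ T (τ - grid T (logHeight T) ((k : ℕ) : ℤ)) *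
    hatR ψ T (τ' - grid T (logHeight T) ((k : ℕ) : ℤ))

/-- **[AF26] eq. (5.8)**: `K_out := LΦ(τ − τ′) − K`, "the sum over `k ∉ [0, d)`" (`hasSum_kerKout`).
[cite: AlpogeFurman2026, §5.2, display before Proposition 5.2 (p. 8)] -/
def kerKout (ψ : ℝ → ℝ) (T τ τ' : ℝ) : ℝ := logHeight T * PhiR ψ T (τ - τ') - kerK ψ T τ τ'

/-- `K` is symmetric. [cite: AlpogeFurman2026, §5.2 (p. 8)] -/
theorem kerK_comm (ψ : ℝ → ℝ) (T τ τ' : ℝ) : kerK ψ T τ τ' = kerK ψ T τ' τ := by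
  unfold kerK; exact Finset.sum_congr rfl fun k _ ↦ mul_comm _ _

/-- **`K = LΦ(τ−τ′) − K_out` with `K_out = Σ_{k∉[0,d)} φ̂(τ − α_k) φ̂(τ′ − α_k)`** (Lemma 2.1).
[cite: AlpogeFurman2026, §5.2 eq. (5.8) (p. 8)] -/
theorem hasSum_kerKout (hψ : IsWindow ψ) {T : ℝ} (hL : 0 < logHeight T) (τ τ' : ℝ) :
    HasSum (fun k : {k : ℤ // k ∉ gridIdx T} ↦
      hatR ψ T (τ - grid T (logHeight T) k) * hatR ψ T (τ' - grid T (logHeight T) k))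
      (kerKout ψ T τ τ') := by
  refine (Finset.hasSum_compl_iff (f := fun k : ℤ ↦ hatR ψ T (τ - grid T (logHeight T) k) *
    hatR ψ T (τ' - grid T (logHeight T) k)) (gridIdx T)).2 ?_
  rw [kerKout, sum_gridIdx, kerK, sub_add_cancel]
  exact hasSum_hatR_mul_hatR hψ hL τ τ'

/-! ## §3. The entries `(G̃ + Ẽ)_{kk′}` as real integrals; `Ẽ := (G̃ + Ẽ) − G̃` -/

/-- **[AF26] eq. (2.11) right-hand side, unnormalised**:
`s_{kk′} := ∫_ℝ φ̂(τ − α_k) φ̂(τ − α_{k′}) ν_X(τ) dτ` (`X = T/2π`), a real number.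
[cite: AlpogeFurman2026, §2.3 eq. (2.11) (pp. 4–5)] -/
def sEntry (ψ : ℝ → ℝ) (T : ℝ) (k k' : Fin (gridDim T)) : ℝ :=
  ∫ τ : ℝ, hatR ψ T (τ - grid T (logHeight T) ((k : ℕ) : ℤ)) *
    hatR ψ T (τ - grid T (logHeight T) ((k' : ℕ) : ℤ)) * weilDensity (T / (2 * π)) τ

/-- `s_{kk′} = s_{k′k}`. [cite: AlpogeFurman2026, §2.3 (p. 4: "real symmetric")] -/
theorem sEntry_comm (ψ : ℝ → ℝ) (T : ℝ) (k k' : Fin (gridDim T)) : sEntry ψ T k k' = sEntry ψ T k' k := by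
  unfold sEntry; exact integral_congr_ae (Eventually.of_forall fun τ ↦ by dsimp only; ring)

/-- The complex integrand of (2.11) is the cast of the real one. [cite: AlpogeFurman2026, §2.3 eq. (2.11) (pp. 4–5)] -/
theorem gramIntegrand_eq (hψ : IsWindow ψ) (T α α' τ : ℝ) :
    hat (fun u ↦ (phi ψ T u : ℂ)) ((τ : ℂ) - α) * hat (fun u ↦ (phi ψ T u : ℂ)) ((τ : ℂ) - α') *
        ((weilDensity (T / (2 * π)) τ : ℝ) : ℂ) =
      ((hatR ψ T (τ - α) * hatR ψ T (τ - α') * weilDensity (T / (2 * π)) τ : ℝ) : ℂ) := by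
  rw [show (τ : ℂ) - α = ((τ - α : ℝ) : ℂ) by push_cast; ring,
    show (τ : ℂ) - α' = ((τ - α' : ℝ) : ℂ) by push_cast; ring,
    hat_phi_ofReal hψ.even, hat_phi_ofReal hψ.even]
  push_cast; ring

/-- The integrand of `s_{kk′}` (indeed of `∫ φ̂(τ−α)φ̂(τ−α′)ν_X(τ)dτ` for any real `α, α′`) is
integrable (`L ≥ 10`). [cite: AlpogeFurman2026, §2.3 eq. (2.11) (pp. 4–5)] -/
theorem integrable_gramIntegrand (hψ : IsWindow ψ) {T : ℝ} (hL : 10 ≤ logHeight T) (α α' : ℝ) :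
    Integrable fun τ : ℝ ↦ hatR ψ T (τ - α) * hatR ψ T (τ - α') * weilDensity (T / (2 * π)) τ := by
  obtain ⟨h1, h2, h3⟩ := integrable_mul_weilDensity_parts (integrable_pairTest_half hψ hL α α')
    (integrable_pairTest_half_mul_digamma hψ hL α α') (T / (2 * π))
  have h := (h1.add h2).add h3
  have e : (fun τ : ℝ ↦ ((hatR ψ T (τ - α) * hatR ψ T (τ - α') * weilDensity (T / (2 * π)) τ : ℝ) : ℂ)) =
      fun y : ℝ ↦ weilMellin (pairTest ψ T α α') (1 / 2 + y * I) * ((archDensity y : ℝ) : ℂ) +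
        weilMellin (pairTest ψ T α α') (1 / 2 + y * I) * ((polarDensity (T / (2 * π)) y : ℝ) : ℂ) +
        weilMellin (pairTest ψ T α α') (1 / 2 + y * I) * ((primeDensity (T / (2 * π)) y : ℝ) : ℂ) := by
    funext τ
    rw [← gramIntegrand_eq hψ, weilMellin_pairTest_half hψ, weilDensity_def]
    push_cast; ring
  have h' : Integrable fun τ : ℝ ↦ ((hatR ψ T (τ - α) * hatR ψ T (τ - α') *
      weilDensity (T / (2 * π)) τ : ℝ) : ℂ) := by rw [e]; exact h
  exact (h'.re).congr (Eventually.of_forall fun τ ↦ by simp)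

/-- **[AF26] eq. (2.11), real form**: for `T ≥ 2π` with `L ≥ 10`,
`Σ_ρ m_ρ φ̂(γ_ρ − α_k) φ̂(γ_ρ − α_{k′}) = s_{kk′}` (the sum over all non-trivial zeros, absolutely
convergent). [cite: AlpogeFurman2026, §2.3 eq. (2.11) (pp. 4–5)] -/
theorem tsum_zeros_eq_sEntry (hψ : IsWindow ψ) {T : ℝ} (hT : 2 * π ≤ T) (hL : 10 ≤ logHeight T)
    (k k' : Fin (gridDim T)) :
    ∑' ρ : ZetaZeros.riemannZetaNontrivialZeros, (riemannZetaZeroOrder (ρ : ℂ) : ℂ) *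
        (hat (fun u ↦ (phi ψ T u : ℂ)) (gammaOf ρ - grid T (logHeight T) ((k : ℕ) : ℤ)) *
          hat (fun u ↦ (phi ψ T u : ℂ)) (gammaOf ρ - grid T (logHeight T) ((k' : ℕ) : ℤ))) =
      (sEntry ψ T k k' : ℂ) := by
  rw [AlpogeFurman2026_gram_entry_formula hψ hT hL, sEntry, ← integral_complex_ofReal]
  exact integral_congr_ae (Eventually.of_forall fun τ ↦ gramIntegrand_eq hψ T _ _ τ)

/-! ### The near zeros inside the subtype of non-trivial zeros -/

/-- The set of non-trivial zeros seen by the window is finite. [cite: AlpogeFurman2026, §2.3 (p. 4)] -/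
theorem nearNtz_finite (T : ℝ) :
    (((↑) : ZetaZeros.riemannZetaNontrivialZeros → ℂ) ⁻¹' nearZeros T).Finite :=
  (nearZeros_finite T).preimage Subtype.val_injective.injOn

/-- The zeros seen by the window, as a `Finset` of the subtype of non-trivial zeros.
[cite: AlpogeFurman2026, §2.3 (p. 4)] -/
def nearNtz (T : ℝ) : Finset ZetaZeros.riemannZetaNontrivialZeros := (nearNtz_finite T).toFinset

/-- Membership in `nearNtz`. [cite: AlpogeFurman2026, §2.3 (p. 4)] -/
theorem mem_nearNtz {T : ℝ} {ρ : ZetaZeros.riemannZetaNontrivialZeros} :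
    ρ ∈ nearNtz T ↔ (ρ : ℂ) ∈ nearZeros T := by
  rw [nearNtz, Set.Finite.mem_toFinset]; rfl

/-- For `T > 1` the zeros seen by the window are non-trivial zeros. [cite: AlpogeFurman2026, §2.3 (p. 4)] -/
theorem nearZeros_subset_ntz {T : ℝ} (hT : 1 < T) :
    nearZeros T ⊆ ZetaZeros.riemannZetaNontrivialZeros := by
  intro ρ hρ
  obtain ⟨h0, h1⟩ := re_mem_Ioo_of_mem_nearZeros hT hρ
  exact mem_riemannZetaNontrivialZeros_iff_holds.2 ⟨hρ.1, h0, h1⟩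

/-- `nearZeroFinset T` is the image of `nearNtz T` (`T > 1`). [cite: AlpogeFurman2026, §2.3 (p. 4)] -/
theorem map_nearNtz {T : ℝ} (hT : 1 < T) :
    (nearNtz T).map ⟨(↑), Subtype.val_injective⟩ = nearZeroFinset T := by
  ext x
  simp only [Finset.mem_map, Function.Embedding.coeFn_mk, mem_nearNtz, mem_nearZeroFinset]
  constructor
  · rintro ⟨ρ, hρ, rfl⟩; exact hρ
  · intro hx; exact ⟨⟨x, nearZeros_subset_ntz hT hx⟩, hx, rfl⟩

/-- Sums over `nearNtz T` are sums over `nearZeroFinset T` (`T > 1`). [cite: AlpogeFurman2026, §2.3 (p. 4)] -/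
theorem sum_nearNtz {M : Type*} [AddCommMonoid M] {T : ℝ} (hT : 1 < T) (f : ℂ → M) :
    ∑ ρ ∈ nearNtz T, f ρ = ∑ ρ ∈ nearZeroFinset T, f ρ := by
  rw [← map_nearNtz hT, Finset.sum_map]
  rfl

/-! ### The matrices `G̃ + Ẽ` and `Ẽ` -/

/-- **[AF26] eq. (2.11), the full matrix `G̃ + Ẽ`**: `(aL²)⁻¹ s_{kk′}` — by (2.11) this is
`(aL²)⁻¹ Σ_{all ρ} m_ρ v_ρ v_ρᵀ` (`hasSum` form below). [cite: AlpogeFurman2026, §2.3 eq. (2.11) (pp. 4–5)] -/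
def fullMatrix (ψ : ℝ → ℝ) (T : ℝ) : Matrix (Fin (gridDim T)) (Fin (gridDim T)) ℂ :=
  fun k k' ↦ gramWeight ψ T * (sEntry ψ T k k' : ℂ)

/-- **[AF26] §2.3, the tail matrix** `Ẽ := (aL²)⁻¹ Σ_{Re γ_ρ ∉ I′} m_ρ v_ρ v_ρᵀ`, DEFINED as
`(G̃ + Ẽ) − G̃` and identified with the printed sum over the far zeros in `hasSum_tailMatrix_apply`.
[cite: AlpogeFurman2026, §2.3 (p. 5, display after (2.10))] -/
def tailMatrix (ψ : ℝ → ℝ) (T : ℝ) : Matrix (Fin (gridDim T)) (Fin (gridDim T)) ℂ :=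
  fullMatrix ψ T - gramMatrix ψ T

/-- `G̃ = (G̃ + Ẽ) − Ẽ`. [cite: AlpogeFurman2026, §2.3 (p. 5)] -/
theorem gramMatrix_eq_full_sub_tail (ψ : ℝ → ℝ) (T : ℝ) :
    gramMatrix ψ T = fullMatrix ψ T - tailMatrix ψ T := by
  rw [tailMatrix, sub_sub_cancel]

/-- The summand `m_ρ φ̂(γ_ρ − α_k) φ̂(γ_ρ − α_{k′})` is absolutely summable over the non-trivial zeros
(`L ≥ 10`). [cite: AlpogeFurman2026, §2.3 eq. (2.11) (pp. 4–5)] -/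
theorem summable_zeroTerm (hψ : IsWindow ψ) {T : ℝ} (hL : 10 ≤ logHeight T) (α α' : ℝ) :
    Summable fun ρ : ZetaZeros.riemannZetaNontrivialZeros ↦ (riemannZetaZeroOrder (ρ : ℂ) : ℂ) *
      (hat (fun u ↦ (phi ψ T u : ℂ)) (gammaOf ρ - α) * hat (fun u ↦ (phi ψ T u : ℂ)) (gammaOf ρ - α')) := by
  have h := summable_pairTest_zeros hψ hL α α'
  simp_rw [weilMellin_pairTest hψ] at h
  exact h.of_norm

/-- **`Ẽ_{kk′} = (aL²)⁻¹ Σ_{Re γ_ρ ∉ I′} m_ρ φ̂(γ_ρ − α_k) φ̂(γ_ρ − α_{k′})`** (the sum over the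
non-trivial zeros NOT seen by the window; `T ≥ 2π`, `L ≥ 10`).
[cite: AlpogeFurman2026, §2.3 (p. 5, display after (2.10)) and eq. (2.11)] -/
theorem hasSum_tailMatrix_apply (hψ : IsWindow ψ) {T : ℝ} (hT : 2 * π ≤ T) (hL : 10 ≤ logHeight T)
    (k k' : Fin (gridDim T)) :
    HasSum (fun ρ : {ρ : ZetaZeros.riemannZetaNontrivialZeros // ρ ∉ nearNtz T} ↦
      gramWeight ψ T * ((riemannZetaZeroOrder ((ρ : ZetaZeros.riemannZetaNontrivialZeros) : ℂ) : ℂ) *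
        (hat (fun u ↦ (phi ψ T u : ℂ))
            (gammaOf ((ρ : ZetaZeros.riemannZetaNontrivialZeros) : ℂ) - grid T (logHeight T) ((k : ℕ) : ℤ)) *
          hat (fun u ↦ (phi ψ T u : ℂ))
            (gammaOf ((ρ : ZetaZeros.riemannZetaNontrivialZeros) : ℂ) - grid T (logHeight T) ((k' : ℕ) : ℤ)))))
      (tailMatrix ψ T k k') := by
  have hπ := Real.pi_gt_three
  have hT1 : 1 < T := by linarith
  set f : ZetaZeros.riemannZetaNontrivialZeros → ℂ := fun ρ ↦ (riemannZetaZeroOrder (ρ : ℂ) : ℂ) *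
    (hat (fun u ↦ (phi ψ T u : ℂ)) (gammaOf ρ - grid T (logHeight T) ((k : ℕ) : ℤ)) *
      hat (fun u ↦ (phi ψ T u : ℂ)) (gammaOf ρ - grid T (logHeight T) ((k' : ℕ) : ℤ))) with hf
  have hsum : HasSum f (sEntry ψ T k k' : ℂ) := by
    rw [← tsum_zeros_eq_sEntry hψ hT hL k k']
    exact (summable_zeroTerm hψ hL _ _).hasSum
  have hcompl : HasSum (fun ρ : {ρ : ZetaZeros.riemannZetaNontrivialZeros // ρ ∉ nearNtz T} ↦ f ρ)
      ((sEntry ψ T k k' : ℂ) - ∑ ρ ∈ nearNtz T, f ρ) := by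
    rw [Finset.hasSum_compl_iff, sub_add_cancel]; exact hsum
  have h := hcompl.mul_left (gramWeight ψ T)
  have e : tailMatrix ψ T k k' = gramWeight ψ T * (sEntry ψ T k k' : ℂ) - gramMatrix ψ T k k' := rfl
  have hs := sum_nearNtz hT1 (fun ρ : ℂ ↦ (riemannZetaZeroOrder ρ : ℂ) *
      (hat (fun u ↦ (phi ψ T u : ℂ)) (gammaOf ρ - grid T (logHeight T) ((k : ℕ) : ℤ)) *
        hat (fun u ↦ (phi ψ T u : ℂ)) (gammaOf ρ - grid T (logHeight T) ((k' : ℕ) : ℤ))))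
  have key : gramWeight ψ T * ((sEntry ψ T k k' : ℂ) - ∑ ρ ∈ nearNtz T, f ρ) = tailMatrix ψ T k k' := by
    rw [e, gramMatrix_apply, ← hs]
    simp only [hf]
    ring
  rw [key] at h
  exact h

/-! ### The Hilbert–Schmidt (Frobenius) size of `Ẽ` from Proposition 4.3 -/

/-- Finite-sum algebra behind "`‖Σ_ρ c_ρ v_ρ v_ρᵀ‖_HS ≤ Σ_ρ c_ρ ‖v_ρ‖₂²`" (squared, `c ≥ 0`):
`Σ_{k,k′} ‖Σ_{ρ∈F} c_ρ a_{ρk} a_{ρk′}‖² ≤ (Σ_{ρ∈F} c_ρ Σ_k ‖a_{ρk}‖²)²`.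
[cite: AlpogeFurman2026, Proposition 4.3 (proof: "`‖v_ρ v_ρᵀ‖₁ = ‖v_ρ‖₂²`"), p. 7] -/
theorem sum_norm_sq_rankOne_le {ι κ : Type*} (F : Finset ι) (K : Finset κ) (c : ι → ℝ)
    (hc : ∀ ρ ∈ F, 0 ≤ c ρ) (a : ι → κ → ℂ) :
    ∑ k ∈ K, ∑ k' ∈ K, ‖∑ ρ ∈ F, (c ρ : ℂ) * (a ρ k * a ρ k')‖ ^ 2 ≤
      (∑ ρ ∈ F, c ρ * ∑ k ∈ K, ‖a ρ k‖ ^ 2) ^ 2 := by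
  -- pointwise: `‖Σ_ρ c a_k a_k'‖ ≤ t_{kk'} := Σ_ρ c ‖a_k‖ ‖a_k'‖`
  have h1 : ∀ k k', ‖∑ ρ ∈ F, (c ρ : ℂ) * (a ρ k * a ρ k')‖ ≤ ∑ ρ ∈ F, c ρ * (‖a ρ k‖ * ‖a ρ k'‖) := by
    intro k k'
    refine (norm_sum_le _ _).trans (Finset.sum_le_sum fun ρ hρ ↦ ?_)
    rw [norm_mul, norm_mul, Complex.norm_real, Real.norm_eq_abs, abs_of_nonneg (hc ρ hρ)]
  have h2 : ∀ k k', ‖∑ ρ ∈ F, (c ρ : ℂ) * (a ρ k * a ρ k')‖ ^ 2 ≤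
      (∑ ρ ∈ F, c ρ * (‖a ρ k‖ * ‖a ρ k'‖)) ^ 2 := fun k k' ↦
    pow_le_pow_left₀ (norm_nonneg _) (h1 k k') 2
  refine (Finset.sum_le_sum fun k _ ↦ Finset.sum_le_sum fun k' _ ↦ h2 k k').trans ?_
  -- expand the squares as double sums over `ρ, ρ'` and use Cauchy–Schwarz in `k`
  have h3 : ∀ k k', (∑ ρ ∈ F, c ρ * (‖a ρ k‖ * ‖a ρ k'‖)) ^ 2 =
      ∑ ρ ∈ F, ∑ ρ' ∈ F, c ρ * c ρ' * ((‖a ρ k‖ * ‖a ρ' k‖) * (‖a ρ k'‖ * ‖a ρ' k'‖)) := by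
    intro k k'
    rw [sq, Finset.sum_mul_sum]
    exact Finset.sum_congr rfl fun ρ _ ↦ Finset.sum_congr rfl fun ρ' _ ↦ by ring
  simp_rw [h3]
  have swap : ∀ G : κ → κ → ι → ι → ℝ,
      ∑ k ∈ K, ∑ k' ∈ K, ∑ ρ ∈ F, ∑ ρ' ∈ F, G k k' ρ ρ' =
        ∑ ρ ∈ F, ∑ ρ' ∈ F, ∑ k ∈ K, ∑ k' ∈ K, G k k' ρ ρ' := by
    intro G
    calc ∑ k ∈ K, ∑ k' ∈ K, ∑ ρ ∈ F, ∑ ρ' ∈ F, G k k' ρ ρ'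
        = ∑ k ∈ K, ∑ ρ ∈ F, ∑ ρ' ∈ F, ∑ k' ∈ K, G k k' ρ ρ' := by
          refine Finset.sum_congr rfl fun k _ ↦ ?_
          rw [Finset.sum_comm]
          exact Finset.sum_congr rfl fun ρ _ ↦ Finset.sum_comm
      _ = ∑ ρ ∈ F, ∑ k ∈ K, ∑ ρ' ∈ F, ∑ k' ∈ K, G k k' ρ ρ' := Finset.sum_comm
      _ = ∑ ρ ∈ F, ∑ ρ' ∈ F, ∑ k ∈ K, ∑ k' ∈ K, G k k' ρ ρ' :=
          Finset.sum_congr rfl fun ρ _ ↦ Finset.sum_comm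
  rw [swap]
  have h4 : ∀ ρ ρ', ∑ k ∈ K, ∑ k' ∈ K, c ρ * c ρ' * ((‖a ρ k‖ * ‖a ρ' k‖) * (‖a ρ k'‖ * ‖a ρ' k'‖)) =
      c ρ * c ρ' * (∑ k ∈ K, ‖a ρ k‖ * ‖a ρ' k‖) ^ 2 := by
    intro ρ ρ'
    rw [sq, Finset.sum_mul_sum, Finset.mul_sum]
    refine Finset.sum_congr rfl fun k _ ↦ ?_
    rw [Finset.mul_sum]
  have h5 : ∀ ρ ∈ F, ∀ ρ' ∈ F, c ρ * c ρ' * (∑ k ∈ K, ‖a ρ k‖ * ‖a ρ' k‖) ^ 2 ≤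
      c ρ * c ρ' * ((∑ k ∈ K, ‖a ρ k‖ ^ 2) * ∑ k ∈ K, ‖a ρ' k‖ ^ 2) := fun ρ hρ ρ' hρ' ↦
    mul_le_mul_of_nonneg_left (Finset.sum_mul_sq_le_sq_mul_sq K _ _) (mul_nonneg (hc ρ hρ) (hc ρ' hρ'))
  calc ∑ ρ ∈ F, ∑ ρ' ∈ F, ∑ k ∈ K, ∑ k' ∈ K, c ρ * c ρ' * ((‖a ρ k‖ * ‖a ρ' k‖) * (‖a ρ k'‖ * ‖a ρ' k'‖))
      = ∑ ρ ∈ F, ∑ ρ' ∈ F, c ρ * c ρ' * (∑ k ∈ K, ‖a ρ k‖ * ‖a ρ' k‖) ^ 2 :=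
        Finset.sum_congr rfl fun ρ _ ↦ Finset.sum_congr rfl fun ρ' _ ↦ h4 ρ ρ'
    _ ≤ ∑ ρ ∈ F, ∑ ρ' ∈ F, c ρ * c ρ' * ((∑ k ∈ K, ‖a ρ k‖ ^ 2) * ∑ k ∈ K, ‖a ρ' k‖ ^ 2) :=
        Finset.sum_le_sum fun ρ hρ ↦ Finset.sum_le_sum fun ρ' hρ' ↦ h5 ρ hρ ρ' hρ'
    _ = (∑ ρ ∈ F, c ρ * ∑ k ∈ K, ‖a ρ k‖ ^ 2) ^ 2 := by
        rw [sq, Finset.sum_mul_sum]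
        exact Finset.sum_congr rfl fun ρ _ ↦ Finset.sum_congr rfl fun ρ' _ ↦ by ring

/-- **[AF26] Proposition 4.3 for the typed `Ẽ`: `‖Ẽ‖_HS ≤ C/√T`** (squared Hilbert–Schmidt norm
`Σ_{k,k′} |Ẽ_{kk′}|² ≤ (C/√T)²` for `T ≥ 300` with `L ≥ 10`), from the partial-sum tail bound of
`CriticalLineTwoThirdsTailProofs` and `‖Σ m_ρ v_ρ v_ρᵀ‖_HS ≤ Σ m_ρ ‖v_ρ‖₂²`, passing to the limit
over finite sets of far zeros. [cite: AlpogeFurman2026, Proposition 4.3 (p. 7)] -/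
theorem sum_norm_sq_tailMatrix_le (hψ : IsWindow ψ) :
    ∃ C : ℝ, 0 ≤ C ∧ ∀ T : ℝ, 300 ≤ T → 10 ≤ logHeight T →
      ∑ k : Fin (gridDim T), ∑ k' : Fin (gridDim T), ‖tailMatrix ψ T k k'‖ ^ 2 ≤
        (C / Real.sqrt T) ^ 2 := by
  obtain ⟨C, hC0, hC⟩ := AlpogeFurman2026_tail_partial_sum_normalised hψ
  refine ⟨C, hC0, fun T hT hL ↦ ?_⟩
  have hπ := Real.pi_lt_d4
  have hT2π : 2 * π ≤ T := by linarith
  have hT1 : 1 < T := by linarith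
  set L := logHeight T with hLdef
  have hL0 : 0 < L := by linarith
  -- the real normalising weight
  set Wr : ℝ := (L * ∫ u : ℝ, phi ψ T u ^ 2)⁻¹ with hWr
  have hWr0 : 0 ≤ Wr := by
    have : 0 ≤ ∫ u : ℝ, phi ψ T u ^ 2 := integral_nonneg fun u ↦ sq_nonneg _
    positivity
  have hW : gramWeight ψ T = (Wr : ℂ) := by
    rw [gramWeight_eq_inv ψ hL0.ne', hWr, Complex.ofReal_inv]
  set a : ZetaZeros.riemannZetaNontrivialZeros → Fin (gridDim T) → ℂ := fun ρ k ↦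
    hat (fun u ↦ (phi ψ T u : ℂ)) (gammaOf (ρ : ℂ) - grid T L ((k : ℕ) : ℤ)) with ha
  -- finite partial sums over far zeros obey the bound
  have hfin : ∀ F : Finset {ρ : ZetaZeros.riemannZetaNontrivialZeros // ρ ∉ nearNtz T},
      ∑ k : Fin (gridDim T), ∑ k' : Fin (gridDim T),
        ‖∑ ρ ∈ F, gramWeight ψ T * ((riemannZetaZeroOrder ((ρ : ZetaZeros.riemannZetaNontrivialZeros) : ℂ) : ℂ) *
          (a ρ k * a ρ k'))‖ ^ 2 ≤ (C / Real.sqrt T) ^ 2 := by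
    intro F
    -- pull out the weight
    have e1 : ∀ k k', ∑ ρ ∈ F, gramWeight ψ T *
        ((riemannZetaZeroOrder ((ρ : ZetaZeros.riemannZetaNontrivialZeros) : ℂ) : ℂ) * (a ρ k * a ρ k')) =
        (Wr : ℂ) * ∑ ρ ∈ F, (((riemannZetaZeroOrder ((ρ : ZetaZeros.riemannZetaNontrivialZeros) : ℂ) : ℝ) : ℂ) *
          (a ρ k * a ρ k')) := by
      intro k k'
      rw [hW, Finset.mul_sum]
      refine Finset.sum_congr rfl fun ρ _ ↦ ?_
      push_cast; ring
    simp_rw [e1, norm_mul, mul_pow, Complex.norm_real, Real.norm_eq_abs, abs_of_nonneg hWr0,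
      ← Finset.mul_sum]
    have hm0 : ∀ ρ ∈ F, (0 : ℝ) ≤ riemannZetaZeroOrder ((ρ : ZetaZeros.riemannZetaNontrivialZeros) : ℂ) :=
      fun ρ _ ↦ Int.cast_nonneg (riemannZetaZeroOrder_nonneg
        (ZetaZeros.riemannZetaNontrivialZeros.ne_one ρ.1.2))
    have h1 := sum_norm_sq_rankOne_le F Finset.univ
      (fun ρ ↦ (riemannZetaZeroOrder ((ρ : ZetaZeros.riemannZetaNontrivialZeros) : ℂ) : ℝ)) hm0
      (fun ρ k ↦ a ρ k)
    -- the tail bound for the image of `F` in `ℂ`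
    set Fc : Finset ℂ := F.image (fun ρ : {ρ : ZetaZeros.riemannZetaNontrivialZeros // ρ ∉ nearNtz T} ↦
      (ρ.1 : ℂ)) with hFc
    have hinj : Set.InjOn (fun ρ : {ρ : ZetaZeros.riemannZetaNontrivialZeros // ρ ∉ nearNtz T} ↦
        (ρ.1 : ℂ)) F := by
      intro x _ y _ h
      exact Subtype.ext (Subtype.ext h)
    have hFc_far : ∀ ρ ∈ Fc, ρ ∈ ZetaZeros.riemannZetaNontrivialZeros ∧ ρ ∉ nearZeros T := by
      intro ρ hρ
      rw [hFc, Finset.mem_image] at hρ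
      obtain ⟨x, -, rfl⟩ := hρ
      exact ⟨x.1.2, fun h ↦ x.2 (mem_nearNtz.2 h)⟩
    have h2 := hC T hT hL Fc hFc_far
    rw [hFc, Finset.sum_image hinj] at h2
    -- `h2 : Wr * Σ_F m Σ_k ‖a‖² ≤ C/√T`
    have h3 : Wr * ∑ ρ ∈ F, (riemannZetaZeroOrder ((ρ : ZetaZeros.riemannZetaNontrivialZeros) : ℂ) : ℝ) *
        ∑ k : Fin (gridDim T), ‖a ρ k‖ ^ 2 ≤ C / Real.sqrt T := h2
    have h4 : 0 ≤ Wr * ∑ ρ ∈ F, (riemannZetaZeroOrder ((ρ : ZetaZeros.riemannZetaNontrivialZeros) : ℂ) : ℝ) *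
        ∑ k : Fin (gridDim T), ‖a ρ k‖ ^ 2 :=
      mul_nonneg hWr0 (Finset.sum_nonneg fun ρ hρ ↦ mul_nonneg (hm0 ρ hρ)
        (Finset.sum_nonneg fun _ _ ↦ sq_nonneg _))
    calc Wr ^ 2 * ∑ k : Fin (gridDim T), ∑ k' : Fin (gridDim T),
          ‖∑ ρ ∈ F, (((riemannZetaZeroOrder ((ρ : ZetaZeros.riemannZetaNontrivialZeros) : ℂ) : ℝ) : ℂ)) *
            (a ρ k * a ρ k')‖ ^ 2
        ≤ Wr ^ 2 * (∑ ρ ∈ F, (riemannZetaZeroOrder ((ρ : ZetaZeros.riemannZetaNontrivialZeros) : ℂ) : ℝ) *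
            ∑ k : Fin (gridDim T), ‖a ρ k‖ ^ 2) ^ 2 := mul_le_mul_of_nonneg_left h1 (sq_nonneg _)
      _ = (Wr * ∑ ρ ∈ F, (riemannZetaZeroOrder ((ρ : ZetaZeros.riemannZetaNontrivialZeros) : ℂ) : ℝ) *
            ∑ k : Fin (gridDim T), ‖a ρ k‖ ^ 2) ^ 2 := by ring
      _ ≤ (C / Real.sqrt T) ^ 2 := pow_le_pow_left₀ h4 h3 2
  -- pass to the limit along finite sets of far zeros
  have hlim : ∀ k k' : Fin (gridDim T), Tendsto
      (fun F : Finset {ρ : ZetaZeros.riemannZetaNontrivialZeros // ρ ∉ nearNtz T} ↦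
        ∑ ρ ∈ F, gramWeight ψ T * ((riemannZetaZeroOrder ((ρ : ZetaZeros.riemannZetaNontrivialZeros) : ℂ) : ℂ) *
          (a ρ k * a ρ k'))) atTop (𝓝 (tailMatrix ψ T k k')) := by
    intro k k'
    have h := hasSum_tailMatrix_apply hψ hT2π hL k k'
    rw [HasSum, SummationFilter.unconditional_filter] at h
    exact h
  have hlim2 : Tendsto (fun F : Finset {ρ : ZetaZeros.riemannZetaNontrivialZeros // ρ ∉ nearNtz T} ↦
      ∑ k : Fin (gridDim T), ∑ k' : Fin (gridDim T),
        ‖∑ ρ ∈ F, gramWeight ψ T * ((riemannZetaZeroOrder ((ρ : ZetaZeros.riemannZetaNontrivialZeros) : ℂ) : ℂ) *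
          (a ρ k * a ρ k'))‖ ^ 2) atTop
      (𝓝 (∑ k : Fin (gridDim T), ∑ k' : Fin (gridDim T), ‖tailMatrix ψ T k k'‖ ^ 2)) :=
    tendsto_finsetSum _ fun k _ ↦ tendsto_finsetSum _ fun k' _ ↦ ((hlim k k').norm.pow 2)
  exact le_of_tendsto' hlim2 hfin

/-! ## §4. Trace algebra: `tr G̃² = tr (G̃+Ẽ)² − 2 tr((G̃+Ẽ)Ẽ) + tr Ẽ²` and Cauchy–Schwarz -/

/-- Cauchy–Schwarz with square roots: `Σ f g ≤ √(Σ f²) √(Σ g²)`. [folklore] -/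
private theorem sum_mul_le_sqrt_mul_sqrt {ι : Type*} (s : Finset ι) (f g : ι → ℝ) :
    ∑ i ∈ s, f i * g i ≤ Real.sqrt (∑ i ∈ s, f i ^ 2) * Real.sqrt (∑ i ∈ s, g i ^ 2) := by
  rw [← Real.sqrt_mul (Finset.sum_nonneg fun _ _ ↦ sq_nonneg _)]
  refine (le_abs_self _).trans ?_
  rw [← Real.sqrt_sq_eq_abs]
  exact Real.sqrt_le_sqrt (Finset.sum_mul_sq_le_sq_mul_sq s f g)

/-- `|tr(AB)| ≤ ‖A‖_HS ‖B‖_HS` for square complex matrices. [cite: AlpogeFurman2026, Theorem 5.7 (proof, last display: "`|‖G̃‖²_HS − ‖G̃+Ẽ‖²_HS| ≤ 2‖G̃+Ẽ‖_HS‖Ẽ‖_HS + ‖Ẽ‖²_HS`"), p. 11] -/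
theorem norm_trace_mul_le {n : Type*} [Fintype n] (A B : Matrix n n ℂ) :
    ‖(A * B).trace‖ ≤ Real.sqrt (∑ i, ∑ j, ‖A i j‖ ^ 2) * Real.sqrt (∑ i, ∑ j, ‖B i j‖ ^ 2) := by
  classical
  rw [Matrix.trace]
  simp only [Matrix.diag_apply, Matrix.mul_apply]
  have h1 : ‖∑ i, ∑ j, A i j * B j i‖ ≤ ∑ i, ∑ j, ‖A i j‖ * ‖B j i‖ :=
    (norm_sum_le _ _).trans (Finset.sum_le_sum fun i _ ↦ (norm_sum_le _ _).trans
      (Finset.sum_le_sum fun j _ ↦ (norm_mul_le _ _)))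
  refine h1.trans ?_
  have h2 : ∑ i, ∑ j, ‖B i j‖ ^ 2 = ∑ i, ∑ j, ‖B j i‖ ^ 2 := Finset.sum_comm
  rw [h2, ← Finset.sum_product', ← Finset.sum_product', ← Finset.sum_product']
  exact sum_mul_le_sqrt_mul_sqrt _ (fun p : n × n ↦ ‖A p.1 p.2‖) (fun p : n × n ↦ ‖B p.2 p.1‖)

/-- **The perturbation step of [AF26] Theorem 5.7**: for square complex matrices `S` (= `G̃ + Ẽ`) and
`E` (= `Ẽ`), `|tr (S−E)² − tr S²| ≤ 2 ‖S‖_HS ‖E‖_HS + ‖E‖²_HS`.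
[cite: AlpogeFurman2026, Theorem 5.7 (proof, last display), p. 11] -/
theorem norm_trace_sq_sub_le {n : Type*} [Fintype n] (S E : Matrix n n ℂ) :
    ‖((S - E) * (S - E)).trace - (S * S).trace‖ ≤
      2 * Real.sqrt (∑ i, ∑ j, ‖S i j‖ ^ 2) * Real.sqrt (∑ i, ∑ j, ‖E i j‖ ^ 2) +
        Real.sqrt (∑ i, ∑ j, ‖E i j‖ ^ 2) ^ 2 := by
  have e : ((S - E) * (S - E)).trace - (S * S).trace = -(2 * (S * E).trace) + (E * E).trace := by
    rw [sub_mul, mul_sub, mul_sub, Matrix.trace_sub, Matrix.trace_sub, Matrix.trace_sub,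
      Matrix.trace_mul_comm E S]
    ring
  rw [e]
  refine (norm_add_le _ _).trans (add_le_add ?_ ?_)
  · rw [norm_neg, norm_mul, Complex.norm_two, mul_assoc]
    exact mul_le_mul_of_nonneg_left (norm_trace_mul_le S E) (by norm_num)
  · rw [sq]; exact norm_trace_mul_le E E

/-- **`tr (G̃+Ẽ)² = (aL²)⁻² Σ_{k,k′} s_{kk′}²`** (the matrix `G̃ + Ẽ` is real symmetric), and
`‖G̃+Ẽ‖²_HS` is the same real number. [cite: AlpogeFurman2026, §5.2 (p. 8: "`(aL²)²‖G̃+Ẽ‖²_HS = ∬ K² ν ν′`")] -/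
theorem trace_fullMatrix_sq (ψ : ℝ → ℝ) {T : ℝ} (hL : logHeight T ≠ 0) :
    (fullMatrix ψ T * fullMatrix ψ T).trace =
      (((logHeight T * ∫ u : ℝ, phi ψ T u ^ 2)⁻¹ ^ 2 *
        ∑ k : Fin (gridDim T), ∑ k' : Fin (gridDim T), sEntry ψ T k k' ^ 2 : ℝ) : ℂ) ∧
    ∑ k : Fin (gridDim T), ∑ k' : Fin (gridDim T), ‖fullMatrix ψ T k k'‖ ^ 2 =
      (logHeight T * ∫ u : ℝ, phi ψ T u ^ 2)⁻¹ ^ 2 *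
        ∑ k : Fin (gridDim T), ∑ k' : Fin (gridDim T), sEntry ψ T k k' ^ 2 := by
  have hW : gramWeight ψ T = (((logHeight T * ∫ u : ℝ, phi ψ T u ^ 2)⁻¹ : ℝ) : ℂ) := by
    rw [gramWeight_eq_inv ψ hL, Complex.ofReal_inv]
  constructor
  · rw [Matrix.trace]
    simp only [Matrix.diag_apply, Matrix.mul_apply, fullMatrix, hW]
    push_cast
    rw [Finset.mul_sum]
    refine Finset.sum_congr rfl fun k _ ↦ ?_
    rw [Finset.mul_sum]
    refine Finset.sum_congr rfl fun k' _ ↦ ?_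
    rw [sEntry_comm ψ T k' k]
    ring
  · simp only [fullMatrix, hW, norm_mul, Complex.norm_real, Real.norm_eq_abs, mul_pow, sq_abs]
    rw [Finset.mul_sum]
    refine Finset.sum_congr rfl fun k _ ↦ ?_
    rw [Finset.mul_sum]

end AlpogeFurman2026

open AlpogeFurman2026 in
/-- **[AF26] Theorem 5.7, the perturbation step, for the typed model**: for a window `ψ` there is
`C ≥ 0` such that for all `T ≥ 300` with `L ≥ 10`, writing `W = (aL²)⁻¹ = (L∫φ_T²)⁻¹` and
`H := W² Σ_{k,k′<d} s_{kk′}²` (`= ‖G̃ + Ẽ‖²_HS = tr (G̃+Ẽ)²`, `trace_fullMatrix_sq`),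
`|tr G̃² − H| ≤ 2 √H · C/√T + C²/T` — the printed
"`|‖G̃‖²_HS − ‖G̃+Ẽ‖²_HS| ≤ 2‖G̃+Ẽ‖_HS ‖Ẽ‖_HS + ‖Ẽ‖²_HS ≪ √N · T^{−1/2}` by Proposition 4.3", with
the evaluation of `H` (Propositions 5.2–5.5) left to the companion files.
[cite: AlpogeFurman2026, Theorem 5.7 (proof, last display), p. 11] -/
theorem AlpogeFurman2026_trace_sq_perturbation {ψ : ℝ → ℝ} (hψ : IsWindow ψ) :
    ∃ C : ℝ, 0 ≤ C ∧ ∀ T : ℝ, 300 ≤ T → 10 ≤ logHeight T →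
      ‖(gramMatrix ψ T * gramMatrix ψ T).trace -
          (((logHeight T * ∫ u : ℝ, phi ψ T u ^ 2)⁻¹ ^ 2 *
            ∑ k : Fin (gridDim T), ∑ k' : Fin (gridDim T), sEntry ψ T k k' ^ 2 : ℝ) : ℂ)‖ ≤
        2 * Real.sqrt ((logHeight T * ∫ u : ℝ, phi ψ T u ^ 2)⁻¹ ^ 2 *
            ∑ k : Fin (gridDim T), ∑ k' : Fin (gridDim T), sEntry ψ T k k' ^ 2) * (C / Real.sqrt T) +
          (C / Real.sqrt T) ^ 2 := by
  obtain ⟨C, hC0, hC⟩ := sum_norm_sq_tailMatrix_le hψ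
  refine ⟨C, hC0, fun T hT hL ↦ ?_⟩
  have hL0 : logHeight T ≠ 0 := by linarith
  obtain ⟨h1, h2⟩ := trace_fullMatrix_sq ψ hL0
  have h3 := norm_trace_sq_sub_le (fullMatrix ψ T) (tailMatrix ψ T)
  rw [← gramMatrix_eq_full_sub_tail, h1, h2] at h3
  have hE : Real.sqrt (∑ i : Fin (gridDim T), ∑ j : Fin (gridDim T), ‖tailMatrix ψ T i j‖ ^ 2) ≤
      C / Real.sqrt T := by
    rw [← Real.sqrt_sq (show 0 ≤ C / Real.sqrt T by positivity)]
    exact Real.sqrt_le_sqrt (hC T hT hL)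
  have hS : 0 ≤ Real.sqrt ((logHeight T * ∫ u : ℝ, phi ψ T u ^ 2)⁻¹ ^ 2 *
      ∑ k : Fin (gridDim T), ∑ k' : Fin (gridDim T), sEntry ψ T k k' ^ 2) := Real.sqrt_nonneg _
  refine h3.trans ?_
  gcongr

end Literature.NumberTheory.LFunctions

end
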